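import Mathlib
import Summits.Ventures.PercRepro2.K5Kernel
import Summits.Ventures.PercRepro2.PMK5Kernel

/-!
# Two more `K₅` kernel facts for the (PM) bracket: the `a₃`-inactive piece `A` is tensor-Bernstein-positive,
and one strictly positive digit of `(HALF-PM⁺)_L` (blind cell PercRepro2, mine-2 g22; row 2′BETA1)

Marks `(o, a₁, a₂, u, b) = (0, 1, 2, 3, 4)` on `K₅`, tables of `K5Kernel.lean` / `PMK5Kernel.lean`.

* **`certA`.**  The `a₃`-inactive piece of the typed bracket `β₁ = (HALF-PM⁺)_L + (HALF-PM⁺)_H + A`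
  (`RootPairSepTyped.lean`; `A ≥ 0` on every graph by BHK 1.4 — `a3piece_nonneg`) is
  `A = (P(uU Q) − P(Q))·[P(Q)P(L_bH_oQ) − P(L_bQ)P(H_oQ) + P(Q)P(H_bL_oQ) − P(H_bQ)P(L_oQ)]`, `uU = {u ∈ C₁ ∪ C₂}`:
  eight products of three masses (`kPosA` / `kNegA`, coefficients `≤ 4 · 3^10 < 2^19`).  The certificate says
  every degree-3 tensor-Bernstein coefficient of `A` is `≥ 0` — with `certL`, `certH` every coefficient of
  `β₁` itself is `≥ 0` on `K₅`: the (TB) form of the typed (PM) (M2-44 (19)) on every 5-vertex base graph.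
* **`digitL`.**  The base-`KB` digit of `kPosL − kNegL` at the profile index `349333 = Σ_e k_e 4^e`,
  `k = (1, 1, 1, 2, 0, 1, 1, 1, 1, 1)` (the edge `{a₁, a₂}` closed in all three copies, the edge `{o, b}` open in
  two), is `446`: that tensor-Bernstein coefficient of the cleared `(HALF-PM⁺)_L` is strictly positive, so the
  bracket is `> 0` at every interior weight vector (`PMK5Strict.lean`) — the equality locus on `K₅` is empty.
-/

namespace Summit.Ventures.PercRepro2

namespace K5

namespace PM

/-- `Q ∩ {u ∈ C₁ ∪ C₂}`. -/
def tQuU (ω : Fin 10 → Bool) : Bool := tQ ω && (conn ω 1 3 || conn ω 2 3)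

/-- The positive part of the cleared `a₃`-inactive piece `A`:
`kron(uUQ)·kron Q·kron(L_bH_oQ) + kron(uUQ)·kron Q·kron(H_bL_oQ) + kron Q·kron(L_bQ)·kron(H_oQ) + kron Q·kron(H_bQ)·kron(L_oQ)`. -/
def kPosA : ℕ := kron tQuU * kron tQ * kron tQBLHo + kron tQuU * kron tQ * kron tQBLo +
  kron tQ * kron tQBL * kron tQHo + kron tQ * kron tQB * kron tQLo

/-- The negative part of the cleared `a₃`-inactive piece `A`:
`kron(uUQ)·kron(L_bQ)·kron(H_oQ) + kron(uUQ)·kron(H_bQ)·kron(L_oQ) + kron Q·kron Q·kron(L_bH_oQ) + kron Q·kron Q·kron(H_bL_oQ)`. -/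
def kNegA : ℕ := kron tQuU * kron tQBL * kron tQHo + kron tQuU * kron tQB * kron tQLo +
  kron tQ * kron tQ * kron tQBLHo + kron tQ * kron tQ * kron tQBLo

set_option maxRecDepth 100000 in
set_option maxHeartbeats 0 in
/-- **The `K₅` certificate of the `a₃`-inactive piece `A`** — every degree-3 tensor-Bernstein coefficient of
the cleared `A` is `≥ 0`: `kPosA ≥ kNegA` digitwise. -/
theorem certA : kNegA ≤ kPosA ∧ Nat.land (kPosA - kNegA) mask = 0 ∧ Nat.land kNegA mask = 0 := by
  decide +kernel

set_option maxRecDepth 100000 in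
set_option maxHeartbeats 0 in
/-- **One strictly positive digit of `(HALF-PM⁺)_L` on `K₅`**: the coefficient of the profile
`(1, 1, 1, 2, 0, 1, 1, 1, 1, 1)` (index `349333`) is `446`. -/
theorem digitL : (kPosL - kNegL) / KB ^ 349333 % KB = 446 := by
  decide +kernel

end PM

end K5

end Summit.Ventures.PercRepro2
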